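import Summits.HubbardSuperconductivity.HubbardSuperconductivity.Theorems.AnisotropyChordTransferFibre3GresZeroSharp

/-!
# Route `AnisotropyChord` / H0 rotor rung: the UPPER ring count `Σ_{|m|∞ = n} 1/|m|² ≤ 2π/n + 2/n²` and the sharp box count from above

Mirror of `…Fibre3GresZeroSharp` (p1 g24: `ring_sum_ge`, `box_sum_ge_sharp` — the ring `|m|∞ = n` of `ℤ²` carries
`Σ 1/|m|² ≈ 2π/n`, a Riemann sum of `∫ du/(1+u²)`).  This file supplies the UPPER side, used by `…Fibre3CapacityUpper`
for the sharp-constant bound `G̃₀(0) ≤ H_{⌊L/2⌋}/(2π) + 0.23` on the torus Green's function at the origin: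
* `arctan_sub_ge`: `arctan((t+1)/M) − arctan(t/M) ≥ M/(M² + (t+1)²)` (mean value theorem, lower side);
  `sum_range_inv_sq_succ_le`: `Σ_{i<M} 1/(M² + (i+1)²) ≤ π/(4M)` (right-endpoint Riemann sum);
* `ringPt_cover`, `ring_eq_image`: the eight half-sides `ringPt` of `…GresZeroSharp` COVER the ring (so they partition it);
* ★ `ring_sum_le`: `Σ_{|m|∞ = n+1} 1/|m|² ≤ 2π/(n+1) + 2/(n+1)²`;
* ★ `box_sum_le_sharp`: `Σ_{0<|m|∞≤N} 1/|m|² ≤ 2πH_N − 3π + 101/10 − 2/N` (`N ≥ 2`; rings `1, 2` exact `= 91/10`) — with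
  `box_sum_ge_sharp` the box sum is pinned between `2πH_N − 3π + 8.1 + 2/N` and `2πH_N − 3π + 10.1 − 2/N`;
* fourth powers: `ring_sum_sq_le` (`Σ_{|m|∞=N+1} 1/|m|⁴ ≤ 8/(N+1)³`), `sum_sdiff_one_sq_le` (`Σ_{1<|m|∞≤N} 1/|m|⁴ ≤ 2 − 4/(N(N+1))`);
* bookkeeping: `puncturedBox_subset`, `puncturedBox_one_eq` (the first ring explicitly), `far_of_mem_sdiff`, `not_far_of_mem_one`.
Prover seat `hubbard-h0-rotor-p1` g25; helper for stmt-HubbardSuperconductivity-19089 (`--supports`).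
WHAT THIS IS NOT: nothing here proves superconductivity in the Hubbard model (rotor TARGET as worded stays FALSE, g15);
elementary lattice-sum bounds serving ONE input (capacity) of ONE input (HOLE₂) of ONE conditional reduction (rung 19089).
Mathlib + tree imports only; no sorry, no axioms.
-/

set_option linter.dupNamespace false
set_option autoImplicit false

noncomputable section

open scoped BigOperators
open Complex

namespace Summit.HubbardSuperconductivity.HubbardSuperconductivity.Theorems.AnisotropyChord.Transfer.Fibre3

variable (L : ℕ) [NeZero L]

/-! ## One ring from above: right-endpoint Riemann sums of `∫ du/(1+u²)` -/

omit [NeZero L] in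
/-- mean value bound from below: `arctan((t+1)/M) − arctan(t/M) ≥ M/(M² + (t+1)²)` for `M > 0`, `t ≥ 0`. [folklore] -/
theorem arctan_sub_ge {M t : ℝ} (hM : 0 < M) (ht : 0 ≤ t) :
    M / (M ^ 2 + (t + 1) ^ 2) ≤ Real.arctan ((t + 1) / M) - Real.arctan (t / M) := by
  have hab : t / M < (t + 1) / M := by
    apply div_lt_div_of_pos_right _ hM; linarith
  obtain ⟨c, hc, hderiv⟩ := exists_hasDerivAt_eq_slope Real.arctan (fun x => 1 / (1 + x ^ 2)) hab
    Real.continuous_arctan.continuousOn (fun x _ => Real.hasDerivAt_arctan x)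
  have hba : (t + 1) / M - t / M = 1 / M := by rw [← sub_div]; ring_nf
  rw [hba] at hderiv
  have hc1 : c ≤ (t + 1) / M := hc.2.le
  have htM : 0 ≤ t / M := by positivity
  have hcpos : 0 ≤ c := le_trans htM hc.1.le
  -- `1/(1+c²) ≥ 1/(1 + ((t+1)/M)²) = M²/(M² + (t+1)²)`
  have h1 : 1 / (1 + ((t + 1) / M) ^ 2) ≤ 1 / (1 + c ^ 2) := by
    apply one_div_le_one_div_of_le (by positivity)
    nlinarith [mul_nonneg hcpos hcpos, mul_le_mul hc1 hc1 hcpos (by positivity)]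
  have h2 : 1 / (1 + ((t + 1) / M) ^ 2) = M ^ 2 / (M ^ 2 + (t + 1) ^ 2) := by
    field_simp
  have hM' : (1 / M) ≠ 0 := by positivity
  rw [eq_div_iff hM'] at hderiv
  rw [← hderiv]
  calc M / (M ^ 2 + (t + 1) ^ 2) = (M ^ 2 / (M ^ 2 + (t + 1) ^ 2)) * (1 / M) := by field_simp
    _ ≤ 1 / (1 + c ^ 2) * (1 / M) := by
        rw [← h2]; exact mul_le_mul_of_nonneg_right h1 (by positivity)

omit [NeZero L] in
/-- ★ `Σ_{i<M} 1/(M² + (i+1)²) ≤ π/(4M)` for `M ≥ 1` (right-endpoint Riemann sum; telescoping `arctan_sub_ge`). [folklore] -/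
theorem sum_range_inv_sq_succ_le (M : ℕ) (hM : 1 ≤ M) :
    ∑ i ∈ Finset.range M, 1 / ((M : ℝ) ^ 2 + ((i : ℝ) + 1) ^ 2) ≤ Real.pi / (4 * M) := by
  have hMpos : (0 : ℝ) < M := by exact_mod_cast (show 0 < M by omega)
  have htel : ∑ i ∈ Finset.range M, (Real.arctan (((i : ℝ) + 1) / M) - Real.arctan ((i : ℝ) / M))
      = Real.pi / 4 := by
    have h := Finset.sum_range_sub (fun i : ℕ => Real.arctan ((i : ℝ) / M)) M
    simp only [Nat.cast_add, Nat.cast_one] at h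
    rw [h, Nat.cast_zero, zero_div, Real.arctan_zero, sub_zero, div_self hMpos.ne', Real.arctan_one]
  have hle : ∑ i ∈ Finset.range M, (M : ℝ) / ((M : ℝ) ^ 2 + ((i : ℝ) + 1) ^ 2)
      ≤ ∑ i ∈ Finset.range M, (Real.arctan (((i : ℝ) + 1) / M) - Real.arctan ((i : ℝ) / M)) :=
    Finset.sum_le_sum fun i _ => arctan_sub_ge hMpos (Nat.cast_nonneg i)
  rw [htel] at hle
  have e : ∑ i ∈ Finset.range M, (M : ℝ) / ((M : ℝ) ^ 2 + ((i : ℝ) + 1) ^ 2)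
      = (M : ℝ) * ∑ i ∈ Finset.range M, 1 / ((M : ℝ) ^ 2 + ((i : ℝ) + 1) ^ 2) := by
    rw [Finset.mul_sum]; refine Finset.sum_congr rfl fun i _ => ?_; field_simp
  rw [e] at hle
  rw [le_div_iff₀ (by positivity)]
  linarith

/-! ## The eight half-sides cover the ring -/

open RateLemma in
omit [NeZero L] in
/-- one rung of the cover: a point of the form `ringPt n (k, i)` with `i ≤ n` lies in the image. [folklore] -/
theorem mem_image_ringPt (n : ℕ) (k : Fin 8) (i : ℕ) (hi : i ≤ n) (m : ℤ × ℤ) (h : ringPt n (k, i) = m) :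
    m ∈ ((Finset.univ : Finset (Fin 8)) ×ˢ Finset.range (n + 1)).image (ringPt n) :=
  Finset.mem_image.mpr ⟨(k, i), by simp only [Finset.mem_product, Finset.mem_univ, Finset.mem_range, true_and]; omega, h⟩

open RateLemma in
omit [NeZero L] in
/-- ★ the eight half-sides COVER the ring `|m|∞ = n+1`. [folklore] -/
theorem ringPt_cover (n : ℕ) :
    puncturedBox (n + 1) \ puncturedBox n ⊆ ((Finset.univ : Finset (Fin 8)) ×ˢ Finset.range (n + 1)).image (ringPt n) := by
  intro m hm
  rw [Finset.mem_sdiff, mem_puncturedBox, mem_puncturedBox] at hm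
  obtain ⟨a, b⟩ := m
  simp only [ne_eq, Prod.mk.injEq] at hm
  push_cast at hm
  have hring : (a = n + 1 ∨ a = -(n + 1) ∨ b = n + 1 ∨ b = -(n + 1)) ∧ -(n + 1 : ℤ) ≤ a ∧ a ≤ n + 1
      ∧ -(n + 1 : ℤ) ≤ b ∧ b ≤ n + 1 := by omega
  obtain ⟨hcases, ha1, ha2, hb1, hb2⟩ := hring
  by_cases hA : a = n + 1
  · by_cases hb : 1 ≤ b
    · obtain ⟨i, hi⟩ := Int.eq_ofNat_of_zero_le (show (0 : ℤ) ≤ b - 1 by omega)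
      exact mem_image_ringPt n 1 i (by omega) _ (by simp only [ringPt, Prod.mk.injEq]; omega)
    · by_cases hb' : -(n : ℤ) ≤ b
      · obtain ⟨i, hi⟩ := Int.eq_ofNat_of_zero_le (show (0 : ℤ) ≤ -b by omega)
        exact mem_image_ringPt n 0 i (by omega) _ (by simp only [ringPt, Prod.mk.injEq]; omega)
      · exact mem_image_ringPt n 7 n le_rfl _ (by simp only [ringPt, Prod.mk.injEq]; omega)
  · by_cases hA' : a = -(n + 1)
    · by_cases hb : b ≤ -1
      · obtain ⟨i, hi⟩ := Int.eq_ofNat_of_zero_le (show (0 : ℤ) ≤ -b - 1 by omega)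
        exact mem_image_ringPt n 3 i (by omega) _ (by simp only [ringPt, Prod.mk.injEq]; omega)
      · by_cases hb' : b ≤ n
        · obtain ⟨i, hi⟩ := Int.eq_ofNat_of_zero_le (show (0 : ℤ) ≤ b by omega)
          exact mem_image_ringPt n 2 i (by omega) _ (by simp only [ringPt, Prod.mk.injEq]; omega)
        · exact mem_image_ringPt n 5 n le_rfl _ (by simp only [ringPt, Prod.mk.injEq]; omega)
    · by_cases hB : b = n + 1
      · by_cases ha : 0 ≤ a
        · obtain ⟨i, hi⟩ := Int.eq_ofNat_of_zero_le ha
          exact mem_image_ringPt n 4 i (by omega) _ (by simp only [ringPt, Prod.mk.injEq]; omega)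
        · obtain ⟨i, hi⟩ := Int.eq_ofNat_of_zero_le (show (0 : ℤ) ≤ -a - 1 by omega)
          exact mem_image_ringPt n 5 i (by omega) _ (by simp only [ringPt, Prod.mk.injEq]; omega)
      · have hB' : b = -(n + 1) := by omega
        by_cases ha : a ≤ 0
        · obtain ⟨i, hi⟩ := Int.eq_ofNat_of_zero_le (show (0 : ℤ) ≤ -a by omega)
          exact mem_image_ringPt n 6 i (by omega) _ (by simp only [ringPt, Prod.mk.injEq]; omega)
        · obtain ⟨i, hi⟩ := Int.eq_ofNat_of_zero_le (show (0 : ℤ) ≤ a - 1 by omega)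
          exact mem_image_ringPt n 7 i (by omega) _ (by simp only [ringPt, Prod.mk.injEq]; omega)

open RateLemma in
omit [NeZero L] in
/-- the ring IS the image of the eight half-sides. [folklore] -/
theorem ring_eq_image (n : ℕ) :
    ((Finset.univ : Finset (Fin 8)) ×ˢ Finset.range (n + 1)).image (ringPt n) = puncturedBox (n + 1) \ puncturedBox n := by
  refine Finset.Subset.antisymm ?_ (ringPt_cover n)
  intro m hm
  rw [Finset.mem_image] at hm
  obtain ⟨p, hp, rfl⟩ := hm
  have : p.2 ≤ n := by
    rw [Finset.mem_product, Finset.mem_range] at hp; omega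
  exact ringPt_mem n p this

open RateLemma in
omit [NeZero L] in
/-- ★ **the ring count from above:** `Σ_{|m|∞ = n+1} 1/|m|² ≤ 2π/(n+1) + 2/(n+1)²`. [folklore] -/
theorem ring_sum_le (n : ℕ) :
    ∑ m ∈ puncturedBox (n + 1) \ puncturedBox n, 1 / (((m.1 ^ 2 + m.2 ^ 2 : ℤ)) : ℝ)
      ≤ 2 * Real.pi / ((n : ℝ) + 1) + 2 / ((n : ℝ) + 1) ^ 2 := by
  have hMpos : (0 : ℝ) < (n : ℝ) + 1 := by positivity
  rw [← ring_eq_image, Finset.sum_image (ringPt_injOn n), Finset.sum_product_right]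
  simp only [sum_fin8_ringPt]
  rw [Finset.sum_add_distrib, ← Finset.mul_sum, ← Finset.mul_sum]
  have hB := sum_range_inv_sq_succ_le (n + 1) (by omega)
  push_cast at hB
  have hA : ∑ i ∈ Finset.range (n + 1), (1 : ℝ) / (((n : ℝ) + 1) ^ 2 + (i : ℝ) ^ 2)
      = (∑ i ∈ Finset.range (n + 1), (1 : ℝ) / (((n : ℝ) + 1) ^ 2 + ((i : ℝ) + 1) ^ 2))
        + 1 / ((n : ℝ) + 1) ^ 2 - 1 / (((n : ℝ) + 1) ^ 2 + ((n : ℝ) + 1) ^ 2) := by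
    have h1 := Finset.sum_range_succ' (fun i : ℕ => (1 : ℝ) / (((n : ℝ) + 1) ^ 2 + (i : ℝ) ^ 2)) (n + 1)
    have h2 := Finset.sum_range_succ (fun i : ℕ => (1 : ℝ) / (((n : ℝ) + 1) ^ 2 + (i : ℝ) ^ 2)) (n + 1)
    simp only [Nat.cast_add, Nat.cast_one, Nat.cast_zero] at h1 h2
    rw [h2] at h1
    have e0 : ((n : ℝ) + 1) ^ 2 + (0 : ℝ) ^ 2 = ((n : ℝ) + 1) ^ 2 := by ring
    rw [e0] at h1
    linarith
  have hlast : 1 / (((n : ℝ) + 1) ^ 2 + ((n : ℝ) + 1) ^ 2) = 1 / (2 * ((n : ℝ) + 1) ^ 2) := by ring_nf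
  rw [hA, hlast]
  have e : 2 * Real.pi / ((n : ℝ) + 1) + 2 / ((n : ℝ) + 1) ^ 2
      = 4 * (Real.pi / (4 * ((n : ℝ) + 1)) + 1 / ((n : ℝ) + 1) ^ 2 - 1 / (2 * ((n : ℝ) + 1) ^ 2))
        + 4 * (Real.pi / (4 * ((n : ℝ) + 1))) := by
    field_simp; ring
  rw [e]
  have h4 : (0 : ℝ) ≤ 4 := by norm_num
  nlinarith [mul_le_mul_of_nonneg_left hB h4]

open RateLemma in
omit [NeZero L] in
/-- ★ **the sharp box count from above:** `Σ_{0<|m|∞≤N} 1/|m|² ≤ 2πH_N − 3π + 101/10 − 2/N` for `N ≥ 2`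
(rings `1, 2` exactly `= 91/10`; rings `n ≥ 3` by `ring_sum_le` with `2/n² + 2/n ≤ 2/(n−1)`). With `box_sum_ge_sharp`
the box sum is pinned: `2πH_N − 3π + 8.1 + 2/N ≤ Σ ≤ 2πH_N − 3π + 10.1 − 2/N`. [folklore] -/
theorem box_sum_le_sharp (N : ℕ) (hN : 2 ≤ N) :
    ∑ m ∈ puncturedBox N, 1 / (((m.1 ^ 2 + m.2 ^ 2 : ℤ)) : ℝ)
      ≤ 2 * Real.pi * (harmonic N : ℝ) - 3 * Real.pi + 101 / 10 - 2 / (N : ℝ) := by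
  induction N with
  | zero => omega
  | succ n ih =>
    rcases Nat.lt_or_ge n 2 with hn | hn
    · -- `N = 2`
      have : n = 1 := by omega
      subst this
      rw [show (1 + 1 : ℕ) = 2 from rfl, puncturedBox_two_sum, harmonic_two]
      push_cast
      nlinarith [Real.pi_pos]
    · have ih' := ih hn
      rw [← Finset.sum_sdiff (puncturedBox_mono n), harmonic_succ, Rat.cast_add, Rat.cast_inv, Rat.cast_natCast,
        Nat.cast_succ]
      have hring := ring_sum_le n
      have hnpos : (0 : ℝ) < n := by exact_mod_cast (show 0 < n by omega)
      have hn1 : (0 : ℝ) < (n : ℝ) + 1 := by positivity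
      -- `2/(n+1)² + 2/(n+1) ≤ 2/n`
      have hkey : 2 / ((n : ℝ) + 1) ^ 2 + 2 / ((n : ℝ) + 1) ≤ 2 / (n : ℝ) := by
        rw [div_add_div _ _ (by positivity) (by positivity), div_le_div_iff₀ (by positivity) hnpos]
        nlinarith
      have e : 2 * Real.pi * ((harmonic n : ℝ) + ((n : ℝ) + 1)⁻¹) = 2 * Real.pi * (harmonic n : ℝ)
          + 2 * Real.pi / ((n : ℝ) + 1) := by rw [mul_add, div_eq_mul_inv]
      rw [e]
      linarith

/-! ## Nested boxes, the first ring, fourth powers -/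

open RateLemma in
omit [NeZero L] in
/-- nested boxes. [folklore] -/
theorem puncturedBox_subset {M N : ℕ} (h : M ≤ N) : puncturedBox M ⊆ puncturedBox N := by
  intro m hm
  rw [mem_puncturedBox] at hm ⊢
  obtain ⟨h0, ⟨h1, h2⟩, ⟨h3, h4⟩⟩ := hm
  have : (M : ℤ) ≤ N := by exact_mod_cast h
  exact ⟨h0, ⟨by omega, by omega⟩, ⟨by omega, by omega⟩⟩

open RateLemma in
omit [NeZero L] in
/-- the first ring, explicitly. [folklore] -/
theorem puncturedBox_one_eq : puncturedBox 1 =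
    {((-1 : ℤ), (-1 : ℤ)), (-1, 0), (-1, 1), (0, -1), (0, 1), (1, -1), (1, 0), (1, 1)} := by
  decide

open RateLemma in
omit [NeZero L] in
/-- outside the first ring both first-ring indicators vanish and the far indicator holds. [folklore] -/
theorem far_of_mem_sdiff {N : ℕ} {m : ℤ × ℤ} (hm : m ∈ puncturedBox N \ puncturedBox 1) :
    ¬ (m.1.natAbs + m.2.natAbs = 1) ∧ ¬ (m.1.natAbs = 1 ∧ m.2.natAbs = 1) ∧ (2 ≤ m.1.natAbs ∨ 2 ≤ m.2.natAbs)
      ∧ m ≠ (0, 0) := by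
  rw [Finset.mem_sdiff, mem_puncturedBox, mem_puncturedBox] at hm
  obtain ⟨⟨h0, -, -⟩, hn⟩ := hm
  have h0' : ¬ (m.1 = 0 ∧ m.2 = 0) := by
    intro h; apply h0; exact Prod.ext h.1 h.2
  push_cast at hn
  have hn' : ¬ ((-1 ≤ m.1 ∧ m.1 ≤ 1) ∧ (-1 ≤ m.2 ∧ m.2 ≤ 1)) := fun h => hn ⟨h0, h.1, h.2⟩
  refine ⟨by omega, by omega, by omega, h0⟩

open RateLemma in
omit [NeZero L] in
/-- inside the first ring the far indicator fails. [folklore] -/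
theorem not_far_of_mem_one {m : ℤ × ℤ} (hm : m ∈ puncturedBox 1) : ¬ (2 ≤ m.1.natAbs ∨ 2 ≤ m.2.natAbs) := by
  rw [mem_puncturedBox] at hm
  obtain ⟨-, ⟨h1, h2⟩, ⟨h3, h4⟩⟩ := hm
  push_cast at h1 h2 h3 h4
  omega

open RateLemma in
omit [NeZero L] in
/-- fourth-power ring count: `Σ_{|m|∞ = N+1} 1/|m|⁴ ≤ 8/(N+1)³`. [folklore] -/
theorem ring_sum_sq_le (N : ℕ) :
    ∑ m ∈ puncturedBox (N + 1) \ puncturedBox N, (1 / (((m.1 ^ 2 + m.2 ^ 2 : ℤ)) : ℝ)) ^ 2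
      ≤ 8 / ((N : ℝ) + 1) ^ 3 := by
  have hN1 : (0 : ℝ) < (N : ℝ) + 1 := by positivity
  have hle : ∀ m ∈ puncturedBox (N + 1) \ puncturedBox N,
      (1 / (((m.1 ^ 2 + m.2 ^ 2 : ℤ)) : ℝ)) ^ 2 ≤ (1 / ((N : ℝ) + 1) ^ 2) ^ 2 := by
    intro m hm
    have h := ring_normSq_ge N m hm
    have h1 : 1 / (((m.1 ^ 2 + m.2 ^ 2 : ℤ)) : ℝ) ≤ 1 / ((N : ℝ) + 1) ^ 2 :=
      one_div_le_one_div_of_le (by positivity) h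
    exact pow_le_pow_left₀ (by positivity) h1 2
  have hcard : ((puncturedBox (N + 1) \ puncturedBox N).card : ℝ) = 8 * ((N : ℝ) + 1) := by
    rw [Finset.card_sdiff_of_subset (puncturedBox_mono N), card_puncturedBox, card_puncturedBox,
      show 4 * (N + 1) * (N + 1 + 1) = 8 * (N + 1) + 4 * N * (N + 1) by ring, Nat.add_sub_cancel]
    push_cast
    ring
  have h := Finset.sum_le_card_nsmul _ _ _ hle
  rw [nsmul_eq_mul, hcard] at h
  calc _ ≤ 8 * ((N : ℝ) + 1) * (1 / ((N : ℝ) + 1) ^ 2) ^ 2 := h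
    _ = 8 / ((N : ℝ) + 1) ^ 3 := by field_simp

open RateLemma in
omit [NeZero L] in
/-- ★ `Σ_{1 < |m|∞ ≤ N} 1/|m|⁴ ≤ 2 − 4/(N(N+1))` (`N ≥ 1`; telescoping `8/n³ ≤ 8/((n−1)n(n+1))`). [folklore] -/
theorem sum_sdiff_one_sq_le (N : ℕ) (hN : 1 ≤ N) :
    ∑ m ∈ puncturedBox N \ puncturedBox 1, (1 / (((m.1 ^ 2 + m.2 ^ 2 : ℤ)) : ℝ)) ^ 2
      ≤ 2 - 4 / ((N : ℝ) * ((N : ℝ) + 1)) := by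
  induction N with
  | zero => omega
  | succ n ih =>
    rcases Nat.lt_or_ge n 1 with hn | hn
    · have : n = 0 := by omega
      subst this
      simp only [zero_add, Finset.sdiff_self, Finset.sum_empty, Nat.cast_one, one_mul]
      norm_num
    · have ih' := ih hn
      have hsub1 : puncturedBox 1 ⊆ puncturedBox (n + 1) := puncturedBox_subset (by omega)
      have hsubn : puncturedBox 1 ⊆ puncturedBox n := puncturedBox_subset hn
      rw [Finset.sum_sdiff_eq_sub hsub1, ← Finset.sum_sdiff (puncturedBox_mono n)]
      rw [Finset.sum_sdiff_eq_sub hsubn] at ih'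
      have hring := ring_sum_sq_le n
      have hnpos : (0 : ℝ) < n := by exact_mod_cast (show 0 < n by omega)
      -- `8/(n+1)³ ≤ 4/(n(n+1)) − 4/((n+1)(n+2))`
      have hkey : 8 / ((n : ℝ) + 1) ^ 3 ≤ 4 / ((n : ℝ) * ((n : ℝ) + 1)) - 4 / (((n : ℝ) + 1) * ((n : ℝ) + 1 + 1)) := by
        rw [div_sub_div _ _ (by positivity) (by positivity), div_le_div_iff₀ (by positivity) (by positivity)]
        nlinarith [sq_nonneg ((n : ℝ) + 1)]
      have hcast : ((n + 1 : ℕ) : ℝ) = (n : ℝ) + 1 := by push_cast; ring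
      rw [hcast]
      linarith

end Summit.HubbardSuperconductivity.HubbardSuperconductivity.Theorems.AnisotropyChord.Transfer.Fibre3

end
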